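import Mathlib
import Summits.ResolutionOfSingularities.ResolutionOfSingularities.Theorems.RadicialJungCleanModelsCleanLU3ArcDischarge
import Summits.ResolutionOfSingularities.ResolutionOfSingularities.Theorems.RadicialJungCleanModelsCleanLU3ArcTower
import Literature.AlgebraicGeometry.Resolution.TranscendenceDefect
import HarnessLib

/-!
# Route `RadicialJung`, crux `CleanModels` (stmt-15917): THEOREM P (res-B-lens-5 g7), part 1 — bricks (P0)–(P2) and regular-system-of-
# parameters bookkeeping (PORT of the kernel-checked crux workfile `Cruxes/DescentPerfectToAll/Lens5_ArcPotential.lean`, 66960002e3bd)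

Line `Sketch` rev 22 of crux stmt-ResolutionOfSingularities-15917; lead `res-B-lead-1` g3 lands the crux workfile of seat res-B-lens-5 g7 (AUTHOR of
the mathematics and of the Lean text; the lead only re-homes it under `Theorems/`, namespace `…Theorems.RadicialJung.CleanModels.Lens5.ArcPotentialProof`).
OURS; nothing here proves resolution in characteristic `p`.  THEOREM P: clean local uniformization along a DISCRETE RANK-ONE zero-dimensional
valuation for `g₀` without best `p`-th-power approximation, given a derivation moving `g₀` — for EVERY residue tower and EVERY ground field —
by a POTENTIAL argument along the quadratic sequence (no deep coordinates, no coefficient fields).  This part: the ultrametric / Jacobian-bound /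
detector bricks and r.s.p. exchange lemmas.
-/

noncomputable section

set_option linter.dupNamespace false -- mandated namespace of this single-conjunct summit
set_option linter.unusedSectionVars false -- ported file: section variables shared across the author's bricks

open IsLocalRing
open Literature.AlgebraicGeometry.Resolution
open Summit.ResolutionOfSingularities.ResolutionOfSingularities.Theorems.RadicialJung.CleanModels

namespace Summit.ResolutionOfSingularities.ResolutionOfSingularities.Theorems.RadicialJung.CleanModels.Lens5.ArcPotentialProof

variable {K : Type} [Field K]

/-! ## Bricks (P0)–(P2) (verbatim from `Census_lens5_arcPotentialCore.lean` ad493c466fcd; crux workfiles do not import one another) -/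

section Bricks

/-- `exists_derivation_pow_mul` (THEOREM P brick, res-B-lens-5 g7; see the module docstring). [folklore] -/
theorem exists_derivation_pow_mul (D : Derivation ℤ K K) {R : Subring K} (hD : ∀ y ∈ R, D y ∈ R)
    {π : K} (hDπ : ∃ ε ∈ R, D π = π * ε) {F : K} (hF : F ∈ R) (a : ℕ) :
    ∃ Φ ∈ R, D (π ^ a * F) = π ^ a * Φ := by
  obtain ⟨ε, hε, hDπ⟩ := hDπ
  induction a with
  | zero => exact ⟨D F, hD F hF, by simp⟩
  | succ n ih =>
    obtain ⟨Φ, hΦ, hn⟩ := ih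
    refine ⟨Φ + F * ε, R.add_mem hΦ (R.mul_mem hF hε), ?_⟩
    have h1 : π ^ (n + 1) * F = π * (π ^ n * F) := by ring
    rw [h1, Derivation.leibniz, smul_eq_mul, smul_eq_mul, hn, hDπ]
    ring

/-- (P1) Jacobian bound. [folklore] -/
theorem jacobian_bound (D : Derivation ℤ K K) {R : Subring K} (hD : ∀ y ∈ R, D y ∈ R)
    {π : K} (hπR : π ∈ R) (hπ0 : π ≠ 0) (hDπ : ∃ ε ∈ R, D π = π * ε)
    {F u : K} (hF : F ∈ R) (hu : ∀ G ∈ R, u ≠ π * G) {a e : ℕ}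
    (h : D (π ^ a * F) = π ^ e * u) : a ≤ e := by
  by_contra hle
  have hlt : e < a := not_le.mp hle
  obtain ⟨Φ, hΦ, hΦeq⟩ := exists_derivation_pow_mul D hD hDπ hF a
  obtain ⟨d, hd⟩ := Nat.exists_eq_add_of_lt hlt
  apply hu (π ^ d * Φ) (R.mul_mem (R.pow_mem hπR d) hΦ)
  have h1 : π ^ e * u = π ^ e * (π * (π ^ d * Φ)) := by
    rw [← h, hΦeq, hd]; ring
  exact mul_left_cancel₀ (pow_ne_zero e hπ0) h1

/-- `jacobian_bound_of_isUnit` (THEOREM P brick, res-B-lens-5 g7; see the module docstring). [folklore] -/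
theorem jacobian_bound_of_isUnit (D : Derivation ℤ K K) {R : Subring K} [IsLocalRing R] (hD : ∀ y ∈ R, D y ∈ R)
    {π : K} (hπR : π ∈ R) (hπ0 : π ≠ 0) (hπm : (⟨π, hπR⟩ : R) ∈ maximalIdeal R) (hDπ : ∃ ε ∈ R, D π = π * ε)
    {F u : K} (hF : F ∈ R) (huR : u ∈ R) (hunit : IsUnit (⟨u, huR⟩ : R)) {a e : ℕ}
    (h : D (π ^ a * F) = π ^ e * u) : a ≤ e := by
  refine jacobian_bound D hD hπR hπ0 hDπ hF (fun G hG hG' => ?_) h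
  have hmem : (⟨u, huR⟩ : R) ∈ maximalIdeal R := by
    have h1 : (⟨u, huR⟩ : R) = ⟨G, hG⟩ * ⟨π, hπR⟩ :=
      Subtype.ext (by change u = G * π; rw [hG', mul_comm])
    rw [h1]
    exact (maximalIdeal R).mul_mem_left _ hπm
  exact (IsLocalRing.mem_maximalIdeal _).mp hmem hunit

variable {O : ValuationSubring K}

/-- `valuation_le_sq_of_mem_sq'` (THEOREM P brick, res-B-lens-5 g7; see the module docstring). [folklore] -/
theorem valuation_le_sq_of_mem_sq' {R : Subring K} [IsLocalRing R] (hdom : SubringDominates R O.toSubring)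
    {π : K} (hπ : ∀ x : K, O.valuation x < 1 → O.valuation x ≤ O.valuation π)
    (y : R) (hy : y ∈ maximalIdeal R ^ 2) : O.valuation (y : K) ≤ O.valuation π ^ 2 := by
  have hmem : ∀ a : R, a ∈ maximalIdeal R ↔ O.valuation (a : K) < 1 :=
    (subringDominates_valuationSubring_iff hdom.1).mp hdom
  rw [pow_two] at hy
  refine Submodule.mul_induction_on hy (fun a ha b hb => ?_) (fun a b ha hb => ?_)
  · rw [Subring.coe_mul, map_mul, pow_two]
    exact mul_le_mul' (hπ _ ((hmem a).mp ha)) (hπ _ ((hmem b).mp hb))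
  · rw [Subring.coe_add]
    exact Valuation.map_add_le _ ha hb

/-- `valuation_lt_one_of_mul_le_sq` (THEOREM P brick, res-B-lens-5 g7; see the module docstring). [folklore] -/
theorem valuation_lt_one_of_mul_le_sq {π x : K} (hπ0 : π ≠ 0) (hvπ1 : O.valuation π < 1)
    (hx : O.valuation (x * π) ≤ O.valuation π ^ 2) : O.valuation x < 1 := by
  have hvπ0 : 0 < O.valuation π := zero_lt_iff.mpr ((Valuation.ne_zero_iff _).mpr hπ0)
  rw [map_mul, pow_two, mul_comm] at hx
  exact lt_of_le_of_lt (le_of_mul_le_mul_left hx hvπ0) hvπ1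

/-- `sub_mul_not_mem_sq` (THEOREM P brick, res-B-lens-5 g7; see the module docstring). [folklore] -/
theorem sub_mul_not_mem_sq {R : Subring K} [IsLocalRing R] (hdom : SubringDominates R O.toSubring)
    {π : K} (hπR : π ∈ R) (hπ0 : π ≠ 0) (hπm : (⟨π, hπR⟩ : R) ∈ maximalIdeal R)
    (hπ : ∀ x : K, O.valuation x < 1 → O.valuation x ≤ O.valuation π)
    (F : R) (hF2 : F ∉ maximalIdeal R ^ 2) (hvF : O.valuation (F : K) ≤ O.valuation π ^ 2) (l : R) :
    F - l * ⟨π, hπR⟩ ∉ maximalIdeal R ^ 2 := by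
  have hmem : ∀ a : R, a ∈ maximalIdeal R ↔ O.valuation (a : K) < 1 :=
    (subringDominates_valuationSubring_iff hdom.1).mp hdom
  intro hq
  have hvq := valuation_le_sq_of_mem_sq' hdom hπ _ hq
  have hvlπ : O.valuation ((l : K) * π) ≤ O.valuation π ^ 2 := by
    have h1 : (l : K) * π = (F : K) - ((F - l * ⟨π, hπR⟩ : R) : K) := by
      push_cast
      ring
    rw [h1]
    exact Valuation.map_sub_le _ hvF hvq
  have hvπ1 : O.valuation π < 1 := (hmem ⟨π, hπR⟩).mp hπm
  have hlm : l ∈ maximalIdeal R := (hmem l).mpr (valuation_lt_one_of_mul_le_sq hπ0 hvπ1 hvlπ)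
  apply hF2
  have h2 : F = (F - l * ⟨π, hπR⟩) + l * ⟨π, hπR⟩ := by ring
  rw [h2]
  exact (maximalIdeal R ^ 2).add_mem hq (by rw [pow_two]; exact Ideal.mul_mem_mul hlm hπm)

/-- (P2) independence of `π`, `F` modulo `𝔪²`. [folklore] -/
theorem indep_of_valuation {R : Subring K} [IsLocalRing R] (hdom : SubringDominates R O.toSubring)
    {π : K} (hπR : π ∈ R) (hπ0 : π ≠ 0) (hπm : (⟨π, hπR⟩ : R) ∈ maximalIdeal R)
    (hπ : ∀ x : K, O.valuation x < 1 → O.valuation x ≤ O.valuation π)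
    (F : R) (hFm : F ∈ maximalIdeal R) (hF2 : F ∉ maximalIdeal R ^ 2) (hvF : O.valuation (F : K) ≤ O.valuation π ^ 2)
    (a b : R) (hab : a * ⟨π, hπR⟩ + b * F ∈ maximalIdeal R ^ 2) : a ∈ maximalIdeal R ∧ b ∈ maximalIdeal R := by
  have hmem : ∀ a : R, a ∈ maximalIdeal R ↔ O.valuation (a : K) < 1 :=
    (subringDominates_valuationSubring_iff hdom.1).mp hdom
  have hb : b ∈ maximalIdeal R := by
    by_contra hbu
    have hbunit : IsUnit b := by
      rwa [IsLocalRing.mem_maximalIdeal, mem_nonunits_iff, not_not] at hbu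
    obtain ⟨w, hw⟩ := hbunit.exists_left_inv
    have h1 : F - (-(w * a)) * ⟨π, hπR⟩ ∈ maximalIdeal R ^ 2 := by
      have h2 : F - (-(w * a)) * ⟨π, hπR⟩ = w * (a * ⟨π, hπR⟩ + b * F) := by
        have h3 : w * (a * ⟨π, hπR⟩ + b * F) = w * a * ⟨π, hπR⟩ + (w * b) * F := by ring
        rw [h3, hw]; ring
      rw [h2]
      exact (maximalIdeal R ^ 2).mul_mem_left _ hab
    exact sub_mul_not_mem_sq hdom hπR hπ0 hπm hπ F hF2 hvF _ h1
  refine ⟨?_, hb⟩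
  have haπ : a * ⟨π, hπR⟩ ∈ maximalIdeal R ^ 2 := by
    have h1 : a * ⟨π, hπR⟩ = (a * ⟨π, hπR⟩ + b * F) - b * F := by ring
    rw [h1]
    exact (maximalIdeal R ^ 2).sub_mem hab (by rw [pow_two]; exact Ideal.mul_mem_mul hb hFm)
  have hv := valuation_le_sq_of_mem_sq' hdom hπ _ haπ
  rw [Subring.coe_mul] at hv
  have hvπ1 : O.valuation π < 1 := (hmem ⟨π, hπR⟩).mp hπm
  exact (hmem a).mpr (valuation_lt_one_of_mul_le_sq hπ0 hvπ1 hv)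

/-- (P0). [folklore] -/
theorem valuation_sub_pow_eq_pow_mul {p : ℕ} [Fact p.Prime] [CharP K p] (O : ValuationSubring K) (π : K) (hπ0 : π ≠ 0)
    (hvπ1 : O.valuation π < 1)
    (hπ : ∀ x : K, O.valuation x < 1 → O.valuation x ≤ O.valuation π)
    (harch : ∀ x : K, x ≠ 0 → ∃ n : ℕ, O.valuation π ^ n ≤ O.valuation x)
    (h : K) (hh : h ∈ O) (hnp : ∀ c : K, c ^ p ≠ h)
    (hdefect : ∀ c : K, ∃ c' : K, O.valuation (h - c' ^ p) < O.valuation (h - c ^ p))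
    (c : K) (hc : c ∈ O) : ∃ j : ℕ, O.valuation (h - c ^ p) = O.valuation π ^ (p * j) := by
  have hvπ0 : 0 < O.valuation π := zero_lt_iff.mpr ((Valuation.ne_zero_iff _).mpr hπ0)
  have hinj : Function.Injective (fun n : ℕ => O.valuation π ^ n) := (pow_right_strictAnti₀ hvπ0 hvπ1).injective
  have hf0 : h - c ^ p ≠ 0 := sub_ne_zero.mpr (Ne.symm (hnp c))
  have hfO : h - c ^ p ∈ O := O.sub_mem hh (O.pow_mem hc p)
  obtain ⟨n, hn⟩ :=
    Summit.ResolutionOfSingularities.ResolutionOfSingularities.Theorems.RadicialJung.CleanModels.exists_valuation_eq_pow_of_discrete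
      O π hπ harch (h - c ^ p) hf0 hfO
  by_cases hpn : p ∣ n
  · obtain ⟨j, rfl⟩ := hpn
    exact ⟨j, hn⟩
  exfalso
  obtain ⟨c', hc'⟩ := hdefect c
  -- `c' ∈ O`: otherwise `v(h − c'^p) = v(c'^p) > 1 ≥ v(h − c^p)`
  have hle1 : O.valuation (h - c ^ p) ≤ 1 := (O.valuation_le_one_iff _).mpr hfO
  have hc'O : c' ∈ O := by
    by_contra hc'O
    have hvc' : 1 < O.valuation c' := by
      rw [← not_le, O.valuation_le_one_iff]; exact hc'O
    have hvc'p : 1 < O.valuation (c' ^ p) := by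
      rw [map_pow]; exact one_lt_pow₀ hvc' (Fact.out : p.Prime).ne_zero
    have hvh : O.valuation h < O.valuation (c' ^ p) := lt_of_le_of_lt ((O.valuation_le_one_iff _).mpr hh) hvc'p
    have heq : O.valuation (h - c' ^ p) = O.valuation (c' ^ p) := Valuation.map_sub_eq_of_lt_right _ hvh
    have : O.valuation (h - c' ^ p) ≤ 1 := (hc'.le.trans hle1)
    rw [heq] at this
    exact absurd hvc'p (not_lt.mpr this)
  -- `d := c^p − c'^p = (h − c'^p) − (h − c^p)` has value `v(h − c^p) = v(π)^n`
  have hd : O.valuation (c ^ p - c' ^ p) = O.valuation π ^ n := by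
    have h1 : c ^ p - c' ^ p = (h - c' ^ p) - (h - c ^ p) := by ring
    rw [h1, Valuation.map_sub_eq_of_lt_right _ hc', hn]
  -- and is `(c − c')^p`
  have hd' : c ^ p - c' ^ p = (c - c') ^ p := (sub_pow_char c c').symm
  have hcc0 : c - c' ≠ 0 := by
    intro h0
    have : O.valuation (c ^ p - c' ^ p) = 0 := by rw [hd', h0, zero_pow (Fact.out : p.Prime).ne_zero, map_zero]
    rw [hd] at this
    exact (pow_ne_zero n hvπ0.ne') this
  obtain ⟨j, hj⟩ :=
    Summit.ResolutionOfSingularities.ResolutionOfSingularities.Theorems.RadicialJung.CleanModels.exists_valuation_eq_pow_of_discrete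
      O π hπ harch (c - c') hcc0 (O.sub_mem hc hc'O)
  have hpow : O.valuation π ^ n = O.valuation π ^ (p * j) := by
    rw [← hd, hd', map_pow, hj, ← pow_mul, mul_comm]
  exact hpn ⟨j, hinj hpow⟩

end Bricks


/-! ## Regular system of parameters bookkeeping in dimension 3 -/

section RSP

variable {S : Type*} [CommRing S] [IsLocalRing S]

/-- A regular local ring of dimension `3` has `𝔪 = (x₀, x₁, x₂)`. [folklore] -/
theorem exists_span_triple [IsNoetherianRing S] (hreg : IsRegularLocalRing S) (hdim : ringKrullDim S = 3) :
    ∃ x₀ x₁ x₂ : S, maximalIdeal S = Ideal.span {x₀, x₁, x₂} := by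
  haveI := hreg
  obtain ⟨x, hx⟩ := exists_regularSystemOfParameters (R := S)
  have hsf : (maximalIdeal S).spanFinrank = 3 := by
    have e := IsRegularLocalRing.spanFinrank_maximalIdeal (R := S)
    rw [hdim] at e; exact_mod_cast e
  let x' : Fin 3 → S := fun j => x (Fin.cast hsf.symm j)
  refine ⟨x' 0, x' 1, x' 2, ?_⟩
  rw [← hx]
  have hr : Set.range x = Set.range x' := by
    ext t
    simp only [Set.mem_range, x']
    constructor
    · rintro ⟨i, rfl⟩; exact ⟨Fin.cast hsf i, by simp⟩
    · rintro ⟨j, rfl⟩; exact ⟨Fin.cast hsf.symm j, rfl⟩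
  rw [hr]
  congr 1
  ext t
  simp only [Set.mem_range, Set.mem_insert_iff, Set.mem_singleton_iff]
  constructor
  · rintro ⟨i, rfl⟩; fin_cases i <;> simp
  · rintro (rfl | rfl | rfl)
    exacts [⟨0, rfl⟩, ⟨1, rfl⟩, ⟨2, rfl⟩]

/-- If `𝔪 = (x₀, x₁, x₂)`, `π ∈ 𝔪 ∖ 𝔪²`, `F ∈ 𝔪`, and `π`, `F` are independent modulo `𝔪²` (`a π + b F ∈ 𝔪² ⇒ b ∈ 𝔪`), then
`𝔪 = (π, F, t₃)` for some `t₃`. [folklore] -/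
theorem exists_span_triple_of_indep (x₀ x₁ x₂ π F : S)
    (hm : maximalIdeal S = Ideal.span {x₀, x₁, x₂}) (hπ : π ∈ maximalIdeal S) (hπ2 : π ∉ maximalIdeal S ^ 2)
    (hF : F ∈ maximalIdeal S) (hind : ∀ a b : S, a * π + b * F ∈ maximalIdeal S ^ 2 → b ∈ maximalIdeal S) :
    ∃ t₃ : S, maximalIdeal S = Ideal.span {π, F, t₃} := by
  obtain ⟨y, z, hy, hz, hmyz⟩ := exists_span_triple_of_not_mem_sq x₀ x₁ x₂ π hm hπ hπ2
  have hF' : F ∈ Ideal.span ({π, y, z} : Set S) := hmyz ▸ hF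
  obtain ⟨a₀, a₁, a₂, hFeq⟩ := (mem_span_triple_iff π y z F).mp hF'
  have perm : ∀ a b c : S, (Ideal.span {a, b, c} : Ideal S) = Ideal.span {b, a, c} := by
    intro a b c
    rw [Set.insert_comm]
  have perm' : ∀ a b c : S, (Ideal.span {a, b, c} : Ideal S) = Ideal.span {c, a, b} := by
    intro a b c
    congr 1
    ext t
    simp only [Set.mem_insert_iff, Set.mem_singleton_iff]
    tauto
  by_cases h₁ : IsUnit a₁
  · refine ⟨z, ?_⟩
    have e := span_triple_exchange y π z F a₁ a₀ a₂ (by rw [hmyz, perm]) (by rw [hFeq]; ring) h₁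
    rw [e, perm]
  by_cases h₂ : IsUnit a₂
  · refine ⟨y, ?_⟩
    have e := span_triple_exchange z π y F a₂ a₀ a₁ (by rw [hmyz, perm']) (by rw [hFeq]; ring) h₂
    rw [e, perm]
  exfalso
  have hm' : ∀ a : S, ¬ IsUnit a → a ∈ maximalIdeal S := fun a ha => (mem_maximalIdeal _).mpr (mem_nonunits_iff.mpr ha)
  have hsq : (-a₀) * π + 1 * F ∈ maximalIdeal S ^ 2 := by
    have e : (-a₀) * π + 1 * F = a₁ * y + a₂ * z := by rw [hFeq]; ring
    rw [e, pow_two]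
    exact Ideal.add_mem _ (Ideal.mul_mem_mul (hm' _ h₁) hy) (Ideal.mul_mem_mul (hm' _ h₂) hz)
  have h1 : (1 : S) ∈ maximalIdeal S := hind _ _ hsq
  exact (maximalIdeal.isMaximal S).ne_top ((Ideal.eq_top_iff_one _).mpr h1)

end RSP


end Summit.ResolutionOfSingularities.ResolutionOfSingularities.Theorems.RadicialJung.CleanModels.Lens5.ArcPotentialProof

end
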